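import Summits.QuantumFields.QCD.Theses.EulerDescent
import Literature.MathematicalPhysics.QuantumFieldTheory.QCDCurrentSector
import Summits.QuantumFields.QCD.Theorems.EulerDescentChiralCornerSoftnessStubSlabFluxBoundCommutators
import Literature.MathematicalPhysics.QuantumFieldTheory.QCDPhaseQuenched
import Literature.MathematicalPhysics.QuantumFieldTheory.QCDSiteReflectionPositivityProofs
import Literature.MathematicalPhysics.QuantumLattice.GrassmannCoefficientRegularity
import HarnessLib

/-!
# Stub `stub_slabFluxBound` (E1) of line `Sketch` (twisted-ray Goldstone bound)
(crux `Summit.QuantumFields.QCD.Theses.EulerDescent.ChiralCornerSoftness`, item stmt-QuantumFields-16902)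

**The slab flux bound is the exact twisted (PCVC) vector Ward identity of a twisted-mass Wilson doublet,
Gauss-summed over the complement of a time slab, in inequality form with constant `K = 2`.**

For `N_f` Wilson flavours on the torus of side `2S+1`, a doublet `f ≠ g`, the degenerate bare mass `m₀`
and the twisted mass `μ ≥ 0` (weight `e^{−ψ̄(D_W(U,m₀) + iμγ₅τ³)ψ}`, `τ³ = E_ff − E_gg`), the flux
`Φ(s₀) = Σ_{y⃗} ⟨(Ṽ²₀(s₀−1,y⃗) − Ṽ²₀(−s₀,y⃗)) P¹(0)⟩` of the conserved point-split current
`Ṽ² = conservedVectorCurrent N_f τ²` (`τ² = −iE_fg + iE_gf`) through the two time slices bounding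
`R = {s₀ ≤ x₀ ≤ 2S+1−s₀}` satisfies, for `1 ≤ s₀ ≤ S`, the EXACT identity

  `Φ(s₀) = −2μ Σ_{s = s₀}^{2S+1−s₀} C(s)`,  `C(s) = Σ_{y⃗} ⟨P¹(0) P¹(s,y⃗)⟩`, `P¹ = ψ̄γ₅τ¹ψ`

(`SlabFluxWard.slabFlux_eq`), whence `‖Φ(s₀)‖ ≤ 2μ Σ_s ‖C(s)‖` (`stub_slabFluxBound`, `K = 2`).

## Proof (everything is proved; no named fact, no hypothesis beyond the registered signature)

§A lives in `EulerDescentChiralCornerSoftnessStubSlabFluxBoundBerezin.lean`, §B and §E in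
`EulerDescentChiralCornerSoftnessStubSlabFluxBoundWardOp.lean`, §C in
`EulerDescentChiralCornerSoftnessStubSlabFluxBoundCommutators.lean`, §D, §F, §G and the registered theorem here.

* §A — generic Grassmann calculus: the left derivative lowers the degree (`grassmannDeriv_mem_exteriorPower`),
  so the Berezin integral of a derivative vanishes (`berezin_grassmannDeriv`, Berezin integration by parts) and
  `∫ θ_X ∂_Y a = δ_{XY} ∫ a`; the substitution derivation `δ_N = Σ N(X,Y) θ_X ∂_Y` is an even derivation with
  `∫ ∘ δ_N = (tr N) ∫` (`berezin_subOp`) and `δ_N e^q = e^q δ_N q` for nilpotent `q` commuting with `δ_N q`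
  (`subOp_grassmannExp`); hence the Schwinger–Dyson identity `∫ (δX) e^q + ∫ X e^q (δq) = 0` for traceless `N`.
* §B — on the torus quark algebra: `quadQ M = Σ M_{vw} ψ̄_v ψ_w` for matrices indexed by quark variables,
  the torus bilinears of `QCDCurrentSector` as `quadQ` of explicit kernels, and the flavour–site rotation
  `ψ ↦ (1+εB)ψ`, `ψ̄ ↦ ψ̄(1−εB)` as a traceless `δ_N` with `δ(ψ̄Mψ) = ψ̄(MB − BM)ψ` (`wardOp_quadQ`) and the Ward
  identity `δX = 0 ⟹ ∫ X ψ̄[M,B]ψ e^{ψ̄Mψ} = 0`.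
* §C — the matrices: for the time-sliced rotation `B_b = b(x₀) τ²` the commutator with the degenerate-mass
  Wilson–Dirac matrix is supported on temporal links, `[D_W, B_b] = Σ_x (b(x₀+1) − b(x₀)) · ker Ṽ²₀(x)`
  (`diracQ_comm_rotQ`: mass term and spatial hops commute, the temporal hops differentiate `b`), and with the
  twisted mass `[iμγ₅τ³, B_b] = 2μ Σ_x b(x₀) · ker P¹(x)` (`twistQ_comm_rotQ`, from `[τ³,τ²] = −2iτ¹`);
  `P¹(0)` is invariant when `b(0) = 0`.
* §D–§F — the placed observables `onTorus` are the `quadQ` of these kernels (`currentObs_onTorus`,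
  `densityObs_onTorus`); with `b = 1_R` the discrete derivative of the indicator picks the two boundary
  slices (`slabInd_succ_sub`), the slices are parametrised by `{−S,…,S}³` (`sum_box_eq_sum_slice`), giving the
  identity at fixed gauge field in the statement's box form (`ward_box`).
* §G — coefficient regularity gives integrability of every Berezin integral against the Wilson probability
  measure; sums and the common denominator are exchanged (`slabFlux_eq`), and the norm bound follows.

References: I. Montvay, G. Münster, *Quantum Fields on a Lattice* (CUP 1994), §5.3.1 (5.149)–(5.150)
(conserved flavour current and its exact lattice Ward identity), §4.4.2 (4.254)–(4.255); R. Frezzotti,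
P. A. Grassi, S. Sint, P. Weisz, JHEP 08 (2001) 058, §2.1 (twisted-mass lattice QCD and the PCVC relation);
F. A. Berezin, *The Method of Second Quantization* (1966), Ch. I §3 (Berezin integration by parts).
-/

noncomputable section

namespace Summit.QuantumFields.QCD.Cruxes.ChiralCornerSoftness.TwistedRay

open Filter Topology MeasureTheory
open Literature.MathematicalPhysics.QuantumFieldTheory Literature.MathematicalPhysics.QuantumLattice
  Literature.Probability.LatticeModels

namespace SlabFluxWard

open Literature.MathematicalPhysics.QuantumLattice.GrassmannAlgebra

/-! ### §D From kernels to the placed observables; the Ward identity at fixed gauge field -/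

section OnTorus

variable {Nf L : ℕ} [NeZero L]

omit [NeZero L] in
/-- `(e₀ + v) mod L = (v mod L) + e₀`. [folklore] -/
theorem torusProj_single_add (v : Literature.Probability.LatticeModels.Site 4) :
    Torus.proj L (Pi.single 0 1 + v) = Torus.proj L v + Pi.single 0 1 := by
  funext i
  simp only [Torus.proj_apply, Pi.add_apply]
  by_cases hi : i = 0
  · subst hi; simp [add_comm]
  · simp [hi]

omit [NeZero L] in
/-- `0 mod L = 0`. [folklore] -/
theorem torusProj_zero : Torus.proj L (0 : Literature.Probability.LatticeModels.Site 4) = 0 := by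
  funext i; simp

/-- **The conserved current placed on the torus is the quadratic action of its kernel.** [folklore] -/
theorem currentObs_onTorus (f g : Fin Nf) (v : Literature.Probability.LatticeModels.Site 4) (U : GaugeConfig 4 L (Matrix.specialUnitaryGroup (Fin 3) ℂ)) :
    (conservedVectorCurrent Nf (tau2M f g) 0).onTorus L v U = quadQ (currQ f g U (Torus.proj L v)) := by
  rw [conservedVectorCurrent_onTorus, torusProj_single_add, currQ, quadQ_smul, quadQ_sub, quadQ_sum, quadQ_sum]
  simp only [quadQ_sum, quadQ_smul, torusBilinear_eq_quadQ]

/-- **The charged density placed on the torus is the quadratic action of its kernel.** [folklore] -/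
theorem densityObs_onTorus (f g : Fin Nf) (v : Literature.Probability.LatticeModels.Site 4) (U : GaugeConfig 4 L (Matrix.specialUnitaryGroup (Fin 3) ℂ)) :
    (pseudoscalarDensityObs Nf (tau1M f g)).onTorus L v U = quadQ (densQ f g (Torus.proj L v)) := by
  rw [pseudoscalarDensityObs, localBilinearObs_onTorus, coe_boxOrigin, zero_add, densQ, quadQ_sum]
  simp only [quadQ_sum, quadQ_smul, torusBilinear_eq_quadQ]

/-- The twisted fermionic weight of the statement, as the exponential of a `quadQ`. [folklore] -/
theorem twWeight_eq (U : GaugeConfig 4 L (Matrix.specialUnitaryGroup (Fin 3) ℂ)) (m₀ μl : ℝ) (f g : Fin Nf) :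
    grassmannExp (quadratic ℂ (-(diracMatrix U (fun _ : Fin Nf => m₀) +
        Matrix.reindex quarkEquiv quarkEquiv (twistQ f g μl)))) =
      grassmannExp (quadQ (-(diracQ U m₀ + twistQ f g μl))) := by
  rw [diracMatrix_eq_reindex_diracQ, quadQ]
  congr 2

/-- **The exact twisted vector Ward identity on the torus at fixed gauge field** for a time-sliced flavour
rotation `b` with `b(0) = 0`, inserted against the charged density at the origin:
`Σ_x (b(x₀+1) − b(x₀)) ∫ P¹(0) Ṽ²₀(x) W + 2μ Σ_x b(x₀) ∫ P¹(0) P¹(x) W = 0`. [folklore] -/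
theorem ward_torus {f g : Fin Nf} (hfg : f ≠ g) (U : GaugeConfig 4 L (Matrix.specialUnitaryGroup (Fin 3) ℂ)) (m₀ μl : ℝ) {b : ZMod L → ℂ}
    (hb : b 0 = 0) :
    ∑ x : TorusSite 4 L, (b (x 0 + 1) - b (x 0)) *
        fermiIntegral (quadQ (densQ f g (0 : TorusSite 4 L)) * quadQ (currQ f g U x) *
          grassmannExp (quadQ (-(diracQ U m₀ + twistQ f g μl)))) +
      2 * (μl : ℂ) * ∑ x : TorusSite 4 L, b (x 0) *
        fermiIntegral (quadQ (densQ f g (0 : TorusSite 4 L)) * quadQ (densQ f g x) *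
          grassmannExp (quadQ (-(diracQ U m₀ + twistQ f g μl)))) = 0 := by
  have hX : wardOp (rotQ f g b) (quadQ (densQ f g (0 : TorusSite 4 L))) = 0 := by
    rw [wardOp_quadQ, densQ_zero_mul_rotQ f g hb, rotQ_mul_densQ_zero f g hb, sub_zero, quadQ_eq_sum]
    simp
  have h := fermiIntegral_mul_quadQ_comm_mul_grassmannExp_eq_zero (rotQ f g b) (-(diracQ U m₀ + twistQ f g μl)) hX
  have hc : -(diracQ U m₀ + twistQ f g μl) * rotQ f g b - rotQ f g b * -(diracQ U m₀ + twistQ f g μl) =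
      -((diracQ U m₀ + twistQ f g μl) * rotQ f g b - rotQ f g b * (diracQ U m₀ + twistQ f g μl)) := by
    rw [Matrix.neg_mul, Matrix.mul_neg]; abel
  rw [hc, quadQ_neg, twDirac_comm_rotQ hfg, mul_neg, neg_mul, map_neg, neg_eq_zero, quadQ_add, quadQ_sum, quadQ_smul,
    quadQ_sum] at h
  simpa only [quadQ_smul, mul_add, add_mul, Finset.mul_sum, Finset.sum_mul, mul_smul_comm, smul_mul_assoc, map_add,
    map_sum, map_smul, smul_eq_mul, Finset.smul_sum] using h

end OnTorus



/-! ### §F The slab flux identity at fixed gauge field, in the statement's box form -/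

section Box

variable {Nf S : ℕ}

/-- The two boundary slices as filtered sums. [folklore] -/
theorem sum_ite_sub_ite_mul {L : ℕ} [NeZero L] (c₁ c₂ : ZMod L) (A : TorusSite 4 L → ℂ) :
    ∑ x : TorusSite 4 L, ((if x 0 = c₁ then (1 : ℂ) else 0) - (if x 0 = c₂ then 1 else 0)) * A x =
      ∑ x ∈ Finset.univ.filter (fun x : TorusSite 4 L => x 0 = c₁), A x -
        ∑ x ∈ Finset.univ.filter (fun x : TorusSite 4 L => x 0 = c₂), A x := by
  simp only [sub_mul, Finset.sum_sub_distrib, ite_mul, one_mul, zero_mul, Finset.sum_filter]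

/-- The slab complement as a union of slices. [folklore] -/
theorem sum_sum_ite_mul {L : ℕ} [NeZero L] (T : Finset ℕ) (G : TorusSite 4 L → ℂ) :
    ∑ x : TorusSite 4 L, (∑ s ∈ T, if x 0 = (s : ZMod L) then (1 : ℂ) else 0) * G x =
      ∑ s ∈ T, ∑ x ∈ Finset.univ.filter (fun x : TorusSite 4 L => x 0 = (s : ZMod L)), G x := by
  simp only [Finset.sum_mul, ite_mul, one_mul, zero_mul, Finset.sum_filter]
  exact Finset.sum_comm

/-- Box parametrisation of the slice at a natural time. [folklore] -/
theorem sum_box_eq_sum_slice_nat (S : ℕ) (s : ℕ) {M : Type*} [AddCommMonoid M] (F : TorusSite 4 (2 * S + 1) → M) :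
    ∑ y ∈ box 3 S, F (Torus.proj (2 * S + 1) (Matrix.vecCons (s : ℤ) y)) =
      ∑ x ∈ Finset.univ.filter (fun x : TorusSite 4 (2 * S + 1) => x 0 = (s : ZMod (2 * S + 1))), F x := by
  rw [sum_box_eq_sum_slice]; simp only [Int.cast_natCast]

/-- **The slab flux identity at fixed gauge field** (Gauss-summed PCVC relation): the flux of `Ṽ²₀` through
the two slices bounding the slab complement, against `P¹(0)`, equals `−2μ` times the slab-summed
`P¹(0)P¹(x)` Berezin integrals. [folklore] -/
theorem ward_box {f g : Fin Nf} (hfg : f ≠ g) {s₀ : ℕ} (hs₀ : 1 ≤ s₀) (hsS : s₀ ≤ S)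
    (U : GaugeConfig 4 (2 * S + 1) (Matrix.specialUnitaryGroup (Fin 3) ℂ)) (m₀ μl : ℝ) :
    ∑ y ∈ box 3 S, fermiIntegral
        (((conservedVectorCurrent Nf (tau2M f g) 0).onTorus (2 * S + 1) (Matrix.vecCons ((s₀ : ℤ) - 1) y) U -
            (conservedVectorCurrent Nf (tau2M f g) 0).onTorus (2 * S + 1) (Matrix.vecCons (-(s₀ : ℤ)) y) U) *
          (pseudoscalarDensityObs Nf (tau1M f g)).onTorus (2 * S + 1) 0 U *
          grassmannExp (quadQ (-(diracQ U m₀ + twistQ f g μl)))) =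
      -(2 * (μl : ℂ)) * ∑ s ∈ (Finset.range (2 * S + 2)).filter (fun s => s₀ ≤ s ∧ s + s₀ ≤ 2 * S + 1),
        ∑ y ∈ box 3 S, fermiIntegral
          ((pseudoscalarDensityObs Nf (tau1M f g)).onTorus (2 * S + 1) 0 U *
              (pseudoscalarDensityObs Nf (tau1M f g)).onTorus (2 * S + 1) (Matrix.vecCons (s : ℤ) y) U *
            grassmannExp (quadQ (-(diracQ U m₀ + twistQ f g μl)))) := by
  have h := ward_torus hfg U m₀ μl (b := slabInd S s₀) (slabInd_zero hs₀)
  simp only [slabInd_succ_sub hs₀ hsS] at h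
  simp only [slabInd_eq_sum hs₀] at h
  rw [sum_ite_sub_ite_mul, sum_sum_ite_mul, ← sum_box_eq_sum_slice S ((s₀ : ℤ) - 1),
    ← sum_box_eq_sum_slice S (-(s₀ : ℤ))] at h
  rw [← Finset.sum_congr rfl fun s _ => sum_box_eq_sum_slice_nat S s
    (fun x => fermiIntegral (quadQ (densQ f g (0 : TorusSite 4 (2 * S + 1))) * quadQ (densQ f g x) *
      grassmannExp (quadQ (-(diracQ U m₀ + twistQ f g μl)))))] at h
  have hcomm : ∀ x : TorusSite 4 (2 * S + 1),
      quadQ (currQ f g U x) * quadQ (densQ f g (0 : TorusSite 4 (2 * S + 1))) =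
        quadQ (densQ f g 0) * quadQ (currQ f g U x) := fun x => (commute_quadQ _ _).eq
  simp only [currentObs_onTorus, densityObs_onTorus, torusProj_zero, sub_mul, map_sub, Finset.sum_sub_distrib,
    hcomm]
  linear_combination h

end Box

/-! ### §G Integration over the gauge field and the bound -/

section Integrate

variable {Nf S : ℕ}

-- adapted from Summits/QuantumFields/QCD/Theorems/HeatSlicedQuarksRobustYangMillsHandoverStubMassDerivativeOfUpdate.lean
/-- The placed observable `U ↦ A.onTorus S v U` is coefficient-regular. [folklore] -/
theorem coeffRegular_onTorus {L : ℕ} [NeZero L] {R : ℕ} (A : QCDLatticeObservable Nf R)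
    (v : Literature.Probability.LatticeModels.Site 4) :
    CoeffRegular (fun U : GaugeConfig 4 L (Matrix.specialUnitaryGroup (Fin 3) ℂ) => A.onTorus L v U) := by
  unfold QCDLatticeObservable.onTorus
  exact ((coeffRegular_boxObs A).comp
    ((Literature.MathematicalPhysics.QuantumLattice.configShift _).measurable.comp
      (measurable_torusLift L))).algHom _

-- adapted from the same file
/-- The Berezin integral of a coefficient-regular variable is integrable against a finite measure. [folklore] -/
theorem integrable_fermiIntegral {L : ℕ} [NeZero L] {Y : GaugeConfig 4 L (Matrix.specialUnitaryGroup (Fin 3) ℂ) → FermiAlg Nf L}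
    (hY : CoeffRegular Y) (μW : Measure (GaugeConfig 4 L (Matrix.specialUnitaryGroup (Fin 3) ℂ))) [IsFiniteMeasure μW] :
    Integrable (fun U => fermiIntegral (Y U)) μW := by
  obtain ⟨C, hC⟩ := hY.exists_norm_apply_le fermiIntegral
  exact Integrable.of_bound (hY.measurable_apply fermiIntegral).aestronglyMeasurable C (Eventually.of_forall hC)

/-- The twisted weight is coefficient-regular. [folklore] -/
theorem coeffRegular_twWeight {L : ℕ} [NeZero L] (m₀ μl : ℝ) (f g : Fin Nf) :
    CoeffRegular (fun U : GaugeConfig 4 L (Matrix.specialUnitaryGroup (Fin 3) ℂ) => grassmannExp (quadratic ℂ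
      (-(diracMatrix U (fun _ : Fin Nf => m₀) + Matrix.reindex quarkEquiv quarkEquiv (twistQ f g μl))))) := by
  refine (coeffRegular_quadratic fun p q => ?_).grassmannExp fun U => coord_empty_quadratic _
  simp only [Matrix.neg_apply, Matrix.add_apply]
  exact (((continuous_diracMatrix _).matrix_elem p q).add continuous_const).neg

/-- **The slab flux identity of the twisted torus functional** (numerators integrated over the Wilson
measure, common denominator): `Φ(s₀) = −2μ Σ_{s ∈ slab} C(s)`. [folklore] -/
theorem slabFlux_eq {f g : Fin Nf} (hfg : f ≠ g) {s₀ : ℕ} (hs₀ : 1 ≤ s₀) (hsS : s₀ ≤ S) (β m₀ μl : ℝ) :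
    ∑ y ∈ box 3 S,
        (∫ U, fermiIntegral
            (((conservedVectorCurrent Nf (tau2M f g) 0).onTorus (2 * S + 1) (Matrix.vecCons ((s₀ : ℤ) - 1) y) U -
                  (conservedVectorCurrent Nf (tau2M f g) 0).onTorus (2 * S + 1) (Matrix.vecCons (-(s₀ : ℤ)) y) U) *
                (pseudoscalarDensityObs Nf (tau1M f g)).onTorus (2 * S + 1) 0 U *
              grassmannExp (quadratic ℂ (-(diracMatrix U (fun _ : Fin Nf => m₀) +
                Matrix.reindex quarkEquiv quarkEquiv (twistQ f g μl)))))
          ∂(wilsonMeasure (d := 4) (L := 2 * S + 1) (fundamentalRep (Fin 3)) β)) /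
        (∫ U, fermiIntegral (grassmannExp (quadratic ℂ (-(diracMatrix U (fun _ : Fin Nf => m₀) +
            Matrix.reindex quarkEquiv quarkEquiv (twistQ f g μl)))))
          ∂(wilsonMeasure (d := 4) (L := 2 * S + 1) (fundamentalRep (Fin 3)) β)) =
      -(2 * (μl : ℂ)) * ∑ s ∈ (Finset.range (2 * S + 2)).filter (fun s => s₀ ≤ s ∧ s + s₀ ≤ 2 * S + 1),
        ∑ y ∈ box 3 S,
          (∫ U, fermiIntegral
              ((pseudoscalarDensityObs Nf (tau1M f g)).onTorus (2 * S + 1) 0 U *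
                  (pseudoscalarDensityObs Nf (tau1M f g)).onTorus (2 * S + 1) (Matrix.vecCons (s : ℤ) y) U *
                grassmannExp (quadratic ℂ (-(diracMatrix U (fun _ : Fin Nf => m₀) +
                  Matrix.reindex quarkEquiv quarkEquiv (twistQ f g μl)))))
            ∂(wilsonMeasure (d := 4) (L := 2 * S + 1) (fundamentalRep (Fin 3)) β)) /
          (∫ U, fermiIntegral (grassmannExp (quadratic ℂ (-(diracMatrix U (fun _ : Fin Nf => m₀) +
              Matrix.reindex quarkEquiv quarkEquiv (twistQ f g μl)))))
            ∂(wilsonMeasure (d := 4) (L := 2 * S + 1) (fundamentalRep (Fin 3)) β)) := by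
  set μW := wilsonMeasure (d := 4) (L := 2 * S + 1) (fundamentalRep (Fin 3)) β with hμW
  set Z := ∫ U, fermiIntegral (grassmannExp (quadratic ℂ (-(diracMatrix U (fun _ : Fin Nf => m₀) +
      Matrix.reindex quarkEquiv quarkEquiv (twistQ f g μl))))) ∂μW with hZ
  have hW := coeffRegular_twWeight (L := 2 * S + 1) m₀ μl f g (Nf := Nf)
  have hP := fun v => coeffRegular_onTorus (L := 2 * S + 1) (pseudoscalarDensityObs Nf (tau1M f g)) v
  have hV := fun v => coeffRegular_onTorus (L := 2 * S + 1) (conservedVectorCurrent Nf (tau2M f g) 0) v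
  -- integrability of every summand
  have hiΦ : ∀ y : Literature.Probability.LatticeModels.Site 3, Integrable (fun U => fermiIntegral
      (((conservedVectorCurrent Nf (tau2M f g) 0).onTorus (2 * S + 1) (Matrix.vecCons ((s₀ : ℤ) - 1) y) U -
            (conservedVectorCurrent Nf (tau2M f g) 0).onTorus (2 * S + 1) (Matrix.vecCons (-(s₀ : ℤ)) y) U) *
          (pseudoscalarDensityObs Nf (tau1M f g)).onTorus (2 * S + 1) 0 U *
        grassmannExp (quadratic ℂ (-(diracMatrix U (fun _ : Fin Nf => m₀) +
          Matrix.reindex quarkEquiv quarkEquiv (twistQ f g μl)))))) μW := fun y => by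
    refine integrable_fermiIntegral ((CoeffRegular.mul ?_ (hP 0)).mul hW) μW
    simpa only [sub_eq_add_neg] using (hV _).add (hV _).neg
  have hiC : ∀ (s : ℕ) (y : Literature.Probability.LatticeModels.Site 3), Integrable (fun U => fermiIntegral
      ((pseudoscalarDensityObs Nf (tau1M f g)).onTorus (2 * S + 1) 0 U *
          (pseudoscalarDensityObs Nf (tau1M f g)).onTorus (2 * S + 1) (Matrix.vecCons (s : ℤ) y) U *
        grassmannExp (quadratic ℂ (-(diracMatrix U (fun _ : Fin Nf => m₀) +
          Matrix.reindex quarkEquiv quarkEquiv (twistQ f g μl)))))) μW := fun s y =>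
    integrable_fermiIntegral (((hP 0).mul (hP _)).mul hW) μW
  -- numerators
  rw [← Finset.sum_div, ← integral_finsetSum _ fun y _ => hiΦ y]
  simp_rw [← Finset.sum_div]
  rw [← mul_div_assoc]
  congr 1
  rw [Finset.sum_congr rfl fun s _ => (integral_finsetSum _ fun y _ => hiC s y).symm,
    ← integral_finsetSum _ fun s _ => integrable_finsetSum _ fun y _ => hiC s y, ← integral_const_mul]
  refine integral_congr_ae (Eventually.of_forall fun U => ?_)
  simp only [twWeight_eq]
  exact ward_box hfg hs₀ hsS U m₀ μl

/-- Norm bookkeeping: an identity `Φ = −2μ Σ C(s)` gives the bound `‖Φ‖ ≤ 2μ Σ ‖C(s)‖`. [folklore] -/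
theorem norm_le_of_eq_neg_two_mul_sum {Φ : ℂ} {μl : ℝ} (hμ : 0 ≤ μl) {T : Finset ℕ} {C : ℕ → ℂ}
    (h : Φ = -(2 * (μl : ℂ)) * ∑ s ∈ T, C s) : ‖Φ‖ ≤ 2 * μl * ∑ s ∈ T, ‖C s‖ := by
  rw [h, norm_mul, norm_neg, norm_mul, Complex.norm_real, Real.norm_of_nonneg hμ, Complex.norm_two]
  exact mul_le_mul_of_nonneg_left (norm_sum_le _ _) (by positivity)

end Integrate

end SlabFluxWard

open SlabFluxWard in
/-- **(E1) The slab flux bound — the exact twisted (PCVC) vector Ward identity of the doublet `(f,g)`,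
Gauss-summed over the complement of the time slab `|y₀| < s₀` on the torus of side `2S+1`, in inequality
form, with `K = 2`.**  For the twisted-mass Wilson doublet (`ψ̄(D_W(U,m₀) + iμγ₅τ³)ψ`) the flux
`Φ(s₀) = Σ_{y⃗} ⟨(Ṽ²₀(s₀−1,y⃗) − Ṽ²₀(−s₀,y⃗)) P¹(0)⟩` of the conserved point-split flavour current
`conservedVectorCurrent Nf τ² 0` through the two slices bounding the slab complement satisfies the EXACT
identity `Φ(s₀) = −2μ Σ_{s₀ ≤ s ≤ 2S+1−s₀} C(s)`, `C(s) = Σ_{y⃗} ⟨P¹(0)P¹(s,y⃗)⟩` (`slabFlux_eq`: Berezin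
integration by parts for the time-sliced flavour rotation `ψ ↦ (1 + ε 1_R τ²)ψ`, `ψ̄ ↦ ψ̄(1 − ε 1_R τ²)`,
whose only non-invariant pieces of the action are the temporal Wilson hops across `∂R` and the twisted
mass, `[iμγ₅τ³, τ²] = 2μγ₅τ¹`), hence `‖Φ(s₀)‖ ≤ 2 μ Σ_s ‖C(s)‖` for `μ ≥ 0`.
[cite: MontvayMunster1994, §5.3.1 (5.149)–(5.150) and §4.4.2 (4.254)–(4.255)] [cite: FrezzottiGrassiSintWeisz2001, §2.1] -/
theorem stub_slabFluxBound :
    ∃ K : ℝ, 0 ≤ K ∧ ∀ (Nf : ℕ) (f g : Fin Nf), f ≠ g → let τ1 : Matrix (Fin Nf) (Fin Nf) ℂ := Matrix.single f g 1 + Matrix.single g f 1; let τ2 : Matrix (Fin Nf) (Fin Nf) ℂ := (-Complex.I) • Matrix.single f g 1 + Complex.I • Matrix.single g f 1; let P1 : QCDLatticeObservable Nf 1 := pseudoscalarDensityObs Nf τ1; let V2 : QCDLatticeObservable Nf 1 := conservedVectorCurrent Nf τ2 0; let Tw := fun (S : ℕ) (μl : ℝ) => Matrix.reindex (quarkEquiv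 (Nf := Nf) (L := 2 * S + 1)) quarkEquiv (Matrix.of fun v w : QuarkVar Nf (2 * S + 1) => if v.1 = w.1 ∧ v.2.1 = w.2.1 ∧ v.2.2.1 = w.2.2.1 then (if v.1 = f then (1 : ℂ) else if v.1 = g then -1 else 0) * ((μl : ℂ) * Complex.I) * gammaFive v.2.2.2 w.2.2.2 else 0); let E := fun (β m₀ μl : ℝ) (S : ℕ) (X : GaugeConfig 4 (2 * S + 1) (Matrix.specialUnitaryGroup (Fin 3) ℂ) → FermiAlg Nf (2 * S + 1)) => (∫ U, fermiIntegral (X U * grassmannExp (quadratic ℂ (-(diracMatrix U (fun _ : Fin Nf => m₀) + Tw S μl)))) ∂(wilsonMeasure (d := 4) (L := 2 * S + 1) (fundamentalRep (Fin 3)) β)) / (∫ U, fermiIntegral (grassmannExp (quadratic ℂ (-(diracMatrix U (fun _ : Fin Nf => m₀) + Tw S μl)))) ∂(wilsonMeasure (d := 4) (L := 2 * S + 1) (fundamentalRep (Fin 3)) β)); let C := fun (β m₀ μl : ℝ) (S : ℕ) (s : ℤ) => ∑ y ∈ box 3 S, E β m₀ μl S (fun U => P1.onTorus (2 * S + 1)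 0 U * P1.onTorus (2 * S + 1) (Matrix.vecCons s y) U); let Φ := fun (β m₀ μl : ℝ) (S : ℕ) (s₀ : ℕ) => ∑ y ∈ box 3 S, E β m₀ μl S (fun U => (V2.onTorus (2 * S + 1) (Matrix.vecCons ((s₀ : ℤ) - 1) y) U - V2.onTorus (2 * S + 1) (Matrix.vecCons (-(s₀ : ℤ)) y) U) * P1.onTorus (2 * S + 1) 0 U); ∀ (β m₀ μl : ℝ) (S s₀ : ℕ), 0 ≤ μl → 1 ≤ s₀ → s₀ ≤ S → ‖Φ β m₀ μl S s₀‖ ≤ K * μl * ∑ s ∈ (Finset.range (2 * S + 2)).filter (fun s => s₀ ≤ s ∧ s + s₀ ≤ 2 * S + 1), ‖C β m₀ μl S s‖ := by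
  refine ⟨2, by norm_num, ?_⟩
  intro Nf f g hfg
  dsimp only
  intro β m₀ μl S s₀ hμ hs₀ hsS
  exact norm_le_of_eq_neg_two_mul_sum hμ (slabFlux_eq hfg hs₀ hsS β m₀ μl)

end Summit.QuantumFields.QCD.Cruxes.ChiralCornerSoftness.TwistedRay
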